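import Mathlib
import HarnessLib
import Summits.AtomisticToContinuum.HydrodynamicLimit.Theorems.RelayRaceLocalityConeLocalisationLocalDefs
import Summits.AtomisticToContinuum.HydrodynamicLimit.Theorems.RelayRaceLocalityConeLocalisationStubFlatteningDensityC

/-!
# RelayRaceLocality · ConeLocalisation — stub `stub_flatteningDensity` (`FlatteningDensity`)

Support file for the crux item `stmt-AtomisticToContinuum-12504` (`ConeLocalisation`, route RelayRaceLocality of
`AtomisticToContinuum/HydrodynamicLimit`), line `zoomed-bubble-transplant` (skeleton
`Cruxes/ConeLocalisation/Lines/Sketch.lean`), stub `stub_flatteningDensity : FlatteningDensity`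
(`Theorems/RelayRaceLocalityConeLocalisationLocalDefs.lean`): the nonlinear flattening of the reduced density
through the reduced activity map `Ψ = hsActivity`.

Parts A–C (`…StubFlatteningDensityA/B/C.lean`) construct, on the analyticity band of the low-density equation of
state, the smooth solution `η₂` of `Ψ(η₂) = ψ Ψ(ρ₁σ³) + (1 - ψ) Ψ(ρ₁(c)σ³)` with values in `[σ³/M, Mσ³]`, the
plateau clauses and the ABSOLUTE scale-`r` bounds `|η₂ - ρ₁(c)σ³| ≤ Kσ³r`, `|∂ᵏη₂| ≤ Kσ³ r^{1-k}` (`flatDen_core`).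
This file normalises by the total mass `s = ∫ η₂ ∈ [σ³/M, Mσ³] ⊆ [σ³/(2M), 2Mσ³]` (`𝕋³` has volume one): since
`|s - ρ₁(c)σ³| ≤ Kσ³r` and — THIS is where the density floor `M⁻¹ ≤ ρ₁` enters — `s ≥ σ³/M`, the relative
deviations are `|η₂/s - 1| ≤ 2KM·r`, `|ρ₁(c)σ³/s - 1| ≤ KM·r`, and `η₂/s` obeys `ScaleDeviation` from `ρ₁(c)σ³/s`
at scale `r` with slope `C_F = 2KM + 1`.
-/

noncomputable section

namespace Summit.AtomisticToContinuum.HydrodynamicLimit.Theorems.ConeLocalisation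

open scoped Topology
open Filter Set MeasureTheory
open Literature.MathematicalPhysics.KineticTheory Literature.Analysis.FluidPDE
  Literature.Analysis.FunctionSpaces
open Summit.AtomisticToContinuum.HydrodynamicLimit.Theses.RelayRaceLocality

/-- **Registered stub `stub_flatteningDensity` of line `Sketch` (zoomed-bubble-transplant): the nonlinear
flattening of the reduced density through the activity map** (`FlatteningDensity`). [folklore] -/
theorem stub_flatteningDensity : FlatteningDensity := by
  obtain ⟨ηF, hηF, hcore⟩ := flatDen_core
  refine ⟨ηF, hηF, fun M hM Cψ hCψ => ?_⟩
  obtain ⟨K, hK, hK'⟩ := hcore M hM Cψ hCψ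
  refine ⟨2 * K * M + 1, by positivity, fun r hr hr16 c ψ hψs hψ01 hψ1 hψ0 hψd σ hσ ρ₁ hρs hρ => ?_⟩
  obtain ⟨η₂, hη₂s, hband, hid, hin, hout, hdev, hder⟩ :=
    hK' r hr hr16 c ψ hψs hψ01 hψ1 hψ0 hψd σ hσ ρ₁ hρs hρ
  have hs3p : 0 < σ ^ 3 := pow_pos hσ 3
  have hMi : 0 < M⁻¹ := inv_pos.2 hM
  have hKM : 0 ≤ K * M := by positivity
  -- the total mass `I = ∫ η₂ ∈ [σ³/M, Mσ³]`, within `Kσ³r` of the far value `b = ρ₁(c)σ³`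
  have hint : Integrable η₂ volume := hη₂s.integrable
  have hconst : ∀ a : ℝ, ∫ _ : T3, a = a := fun a => by simp
  have hIlo : M⁻¹ * σ ^ 3 ≤ ∫ x, η₂ x := by
    have h := integral_mono (integrable_const (M⁻¹ * σ ^ 3)) hint fun x => (hband x).1
    rwa [hconst] at h
  have hIhi : (∫ x, η₂ x) ≤ M * σ ^ 3 := by
    have h := integral_mono hint (integrable_const (M * σ ^ 3)) fun x => (hband x).2
    rwa [hconst] at h
  set I : ℝ := ∫ x, η₂ x with hI
  set b : ℝ := ρ₁ c * σ ^ 3 with hb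
  have hIpos : 0 < I := (mul_pos hMi hs3p).trans_le hIlo
  have hsI : σ ^ 3 ≤ M * I := by
    calc σ ^ 3 = M * (M⁻¹ * σ ^ 3) := by field_simp
      _ ≤ M * I := mul_le_mul_of_nonneg_left hIlo hM.le
  have hIb : |I - b| ≤ K * σ ^ 3 * r := by
    have hlo : ∀ x, b - K * σ ^ 3 * r ≤ η₂ x := fun x => by
      have := hdev x; rw [abs_le] at this; linarith only [this.1]
    have hhi : ∀ x, η₂ x ≤ b + K * σ ^ 3 * r := fun x => by
      have := hdev x; rw [abs_le] at this; linarith only [this.2]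
    have h1 := integral_mono (integrable_const _) hint hlo
    have h2 := integral_mono hint (integrable_const _) hhi
    rw [hconst] at h1 h2
    rw [abs_le]; constructor <;> linarith only [h1, h2]
  -- the key division estimate: `X σ³ / I ≤ X M` for `X ≥ 0`
  have key : ∀ X : ℝ, 0 ≤ X → X * σ ^ 3 / I ≤ X * M := fun X hX => by
    rw [div_le_iff₀ hIpos]; nlinarith only [hsI, hX]
  refine ⟨η₂, hη₂s, fun x => (mul_pos hMi hs3p).trans_le (hband x).1, hid, hin, hout, ?_, ?_,
    fun x => ?_, ?_, fun x => ⟨?_, fun i j k => ?_⟩⟩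
  · -- `(2M)⁻¹ σ³ ≤ I`
    calc (2 * M)⁻¹ * σ ^ 3 ≤ M⁻¹ * σ ^ 3 := by
          refine mul_le_mul_of_nonneg_right ?_ hs3p.le
          rw [inv_le_inv₀ (by positivity) hM]; linarith only [hM]
      _ ≤ I := hIlo
  · -- `I ≤ 2Mσ³`
    calc I ≤ M * σ ^ 3 := hIhi
      _ ≤ 2 * M * σ ^ 3 := by nlinarith only [hM, hs3p]
  · -- `|η₂ x / I - 1| ≤ C_F r`
    rw [div_sub_one hIpos.ne', abs_div, abs_of_pos hIpos, div_le_iff₀ hIpos]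
    have h1 : |η₂ x - I| ≤ 2 * K * (σ ^ 3) * r := by
      calc |η₂ x - I| = |(η₂ x - b) + (b - I)| := by ring_nf
        _ ≤ |η₂ x - b| + |b - I| := abs_add_le _ _
        _ ≤ K * σ ^ 3 * r + K * σ ^ 3 * r := add_le_add (hdev x) (by rw [abs_sub_comm]; exact hIb)
        _ = 2 * K * σ ^ 3 * r := by ring
    have h2 : 2 * K * σ ^ 3 * r ≤ (2 * K * M + 1) * r * I := by
      have h3 : 2 * K * σ ^ 3 ≤ 2 * K * M * I := by nlinarith only [hsI, hK]
      have h4 := mul_le_mul_of_nonneg_right h3 hr.le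
      have h5 : 0 ≤ r * I := by positivity
      nlinarith only [h4, h5]
    exact h1.trans h2
  · -- `|b / I - 1| ≤ C_F r`
    rw [div_sub_one hIpos.ne', abs_div, abs_of_pos hIpos, div_le_iff₀ hIpos, abs_sub_comm]
    have h2 : K * σ ^ 3 * r ≤ (2 * K * M + 1) * r * I := by
      have h3 : K * σ ^ 3 ≤ K * M * I := by nlinarith only [hsI, hK]
      have h4 := mul_le_mul_of_nonneg_right h3 hr.le
      have h5 : 0 ≤ (K * M + 1) * (r * I) := by positivity
      nlinarith only [h4, h5]
    exact hIb.trans h2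
  · -- `ScaleDeviation`, order zero
    rw [← sub_div, abs_div, abs_of_pos hIpos, div_le_iff₀ hIpos]
    have h3 : K * σ ^ 3 ≤ K * M * I := by nlinarith only [hsI, hK]
    have h4 := mul_le_mul_of_nonneg_right h3 hr.le
    have h5 : 0 ≤ (K * M + 1) * (r * I) := by positivity
    have h2 : K * σ ^ 3 * r ≤ (2 * K * M + 1) * r * I := by nlinarith only [h4, h5]
    exact (hdev x).trans h2
  · -- `ScaleDeviation`, orders one to three
    have hdiv : (fun y => η₂ y / I) = fun y => I⁻¹ * η₂ y := by funext y; rw [div_eq_inv_mul]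
    rw [hdiv, (Torus.partialDeriv₃_const_mul hη₂s I⁻¹ i i i x).1,
      (Torus.partialDeriv₃_const_mul hη₂s I⁻¹ j i i x).2.1, (Torus.partialDeriv₃_const_mul hη₂s I⁻¹ k j i x).2.2,
      abs_mul, abs_mul, abs_mul, abs_of_pos (inv_pos.2 hIpos)]
    obtain ⟨d1, d2, d3⟩ := hder x i j k
    have hKM' : K * M ≤ 2 * K * M + 1 := by linarith only [hKM]
    have e : ∀ t : ℝ, I⁻¹ * t = t / I := fun t => by rw [inv_mul_eq_div]
    refine ⟨?_, ?_, ?_⟩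
    · rw [e]
      calc |Torus.partialDeriv i η₂ x| / I ≤ K * σ ^ 3 / I := div_le_div_of_nonneg_right d1 hIpos.le
        _ ≤ K * M := key K hK.le
        _ ≤ 2 * K * M + 1 := hKM'
    · rw [e]
      calc |Torus.partialDeriv i (Torus.partialDeriv j η₂) x| / I ≤ K * σ ^ 3 / r / I :=
            div_le_div_of_nonneg_right d2 hIpos.le
        _ = K * σ ^ 3 / I / r := by rw [div_right_comm]
        _ ≤ K * M / r := div_le_div_of_nonneg_right (key K hK.le) hr.le
        _ ≤ (2 * K * M + 1) / r := div_le_div_of_nonneg_right hKM' hr.le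
    · rw [e]
      calc |Torus.partialDeriv i (Torus.partialDeriv j (Torus.partialDeriv k η₂)) x| / I ≤
            K * σ ^ 3 / r ^ 2 / I := div_le_div_of_nonneg_right d3 hIpos.le
        _ = K * σ ^ 3 / I / r ^ 2 := by rw [div_right_comm]
        _ ≤ K * M / r ^ 2 := div_le_div_of_nonneg_right (key K hK.le) (by positivity)
        _ ≤ (2 * K * M + 1) / r ^ 2 := div_le_div_of_nonneg_right hKM' (by positivity)

end Summit.AtomisticToContinuum.HydrodynamicLimit.Theorems.ConeLocalisation

end
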